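/-
Copyright (c) 2026 the pub-hodgecm-mathlib formalisation cell (harness21).  Prover seat hodgecm-mathlib-LH4-p12 (g5), Track A «(D-RAM) FOUR-FRAME», unit U2H, the (ρ2b′-X)
census road — typed bottom socket (B), organ (B-dK) «`dK = d` on type RamK» (payer LH4-p14 (g5) 07:12:17Z: «(B-dK) → LH4-p12 (g5), WHOLE»; (B) lead LH4-p07 (g7) LINE #5 seam (S-H)).
2026-09-04.
-/
import Summits.HodgeConjecture.HodgeConjecture.Theorems.F0P3cDyRamFrameRamKAtPlace       -- ★ p857989 + ED. 3 p858208 (this seat): (dK-1) `isRamifiedQuadraticDatum_transport`, (dK-2) `v_sub_rho_eq_of_tau_fixed`; brings ★ KleinDifferentLetters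
import Literature.NumberTheory.Automorphic.QuadraticDatumClassLinkOneField               -- ★ (LH4-p09 (g5)): the roots `τ, τ′` of the datum inside `M`: `map_root_eq_conj`, `map_map_root_eq`; brings ★ `root_sum_and_prod`
import Literature.NumberTheory.Automorphic.UnitaryThreeFourFrameDefs                     -- D `IsRamifiedQuadraticDatum`
import HarnessLib

/-!
# F0 · P3c · line LH4 «(D-RAM) FOUR-FRAME» — unit U2H, leaf (ρ2b′-X), typed bottom (B): organ (B-dK) — THE DISCRIMINANT DEPTH OF THE DESCENT FIELD IS THE E-DATUM'S `d`
# (`dK = d` on type RamK), ONE-FIELD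

Cell `pub/hodgecm-mathlib` (D-0151), crux H413 = `stmt-HodgeConjecture-24833` (helper lane `--supports`, count-neutral); THEOREMS ONLY (no definition, no instance, no notation, no
named fact, no `sorry`).  Socket served: (B) `SOCKET-hOCB.v1.LH4p14g4.txt` 17cfa65daaa478aa through the (B) HEAD's seam (S-H) (LH4-p07 (g7) LINE #5): the H-side chain ★ p857701
`hSide_closedForm_of_tube_exists` hands an EISENSTEIN datum `(uτ, wτ, z)` of the descent discriminant `D = tr² g − 4 det g` with `hdK : |uτ² + 4wτ|_F = |ϖ_F|^{dK}` and the level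
identity in `2n + dK`; the RamK weld's exponent is `(jl − d)∕2 + 1`; ★ p858041 `condLevel_eq_of_hlev` gives `jl = 2n + dK`; so the composition needs **`dK = d`** — O'Meara 63:3 ∕
Serre III §4 Prop. 8 «unramified base change preserves the different», here proved in ONE-FIELD letters inside the eigen-field model `M` (involutions `ρ = Gal(M∕E)`, `Θ` (fixing `K♮`),
base `j : F →+* M` with `|j y| = |y|²`):

* (dK-1) = ★ p857989 `isRamifiedQuadraticDatum_transport` (`d(M ∕ K♮) = d(E ∕ F)` at type B); (dK-2) = ★ p858208 `v_sub_rho_eq_of_tau_fixed` (every `Θρ`-FIXED uniformiser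
  `π` of `M` has `ρ`-depth `d`: `|π − ρπ| = |π|^d`);
* `discDepth_eq_of_eisenstein` — **(dK-3) = (B-dK)**: for an Eisenstein datum `(u, w, z)` of `D` (`(u² + 4w)·z² = D`, `z ≠ 0`, `|w|_F = |ϖ_F| = exp(−1)`) with square-root witness
  `r ∈ M` (`ρ r = −r`, `Θ(ρ r) = r`, `r² = j D` — ★ p857834's `r₀`), the root `τ := (ju + r∕jz)∕2` (★ `QuadraticDatumClassLinkOneField` §1: `ρτ = τ′`, `Θ(ρτ) = τ`) is a
  `Θρ`-fixed UNIFORMISER of `M` (`|τ·τ′| = |jw| = exp(−2)`, `|τ| = |τ′|`), so by (dK-2) `|τ − τ′| = exp(−d)`; and `(τ − τ′)² = (r∕jz)² = j(u² + 4w)`, whence `|u² + 4w|_F² = exp(−2d)`: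
  **`dK = d`** against `hdK : |u² + 4w|_F = |ϖ_F|^{dK}`.
HONEST LABEL: HC_CM is proved only modulo the 7 printed citations (2 remaining named inputs: hLiu418 = stmt-HodgeConjecture-24832, h413 = stmt-HodgeConjecture-24833) until rung 0 closes;
socket (B) is OPEN — this organ closes no socket by itself; count-neutral.

## References
* [Serre1979] J.-P. Serre, *Local Fields*, GTM 67 (1979), Ch. III §4 Prop. 8 (transitivity of the different), Ch. I §6 Prop. 17–18 (Eisenstein equations: a root is a uniformiser),
  Ch. IV §1 Prop. 4.
* [Omeara1963] O. T. O'Meara, *Introduction to Quadratic Forms*, Grundlehren 117 (1963), §63B (63:3) (local quadratic extensions: discriminant and the unramified twist).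
* [LabesseLanglands1979] J.-P. Labesse, R. P. Langlands, *L-indistinguishability for SL(2)*, Canad. J. Math. 31 (1979), §2 pp. 7–8.
-/

set_option autoImplicit false

noncomputable section

namespace Summit.HodgeConjecture.HodgeConjecture.Cruxes.H413.F0P3cDyRamRamKDiscDepth

open WithZero
open Literature.NumberTheory.Automorphic.UnitaryThreeFourFrame
open Literature.NumberTheory.Automorphic.HermitianLatticeTree
open scoped Valued

/-! ## (dK-3) `dK = d`: the Eisenstein datum's discriminant depth is the Θ-datum's depth -/

/-- **(B-dK) `dK = d` ON TYPE RamK, ONE-FIELD.**  In the eigen-field model `M` with base `j : F →+* M`, `|j y| = |y|²`, `ρ` and `Θ` fixing `jF`, `ρ` isometric, `Θ` an involution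
carrying a ramified quadratic datum of depth `d` (`d(M ∕ K♮) = d`, ★ `isRamifiedQuadraticDatum_transport` at type B): for an EISENSTEIN datum `(u, w, z)` of `D` (`(u² + 4w)z² = D`,
`z ≠ 0`, `|w|_F = |ϖ_F|`, `|ϖ_F| = exp(−1)`) with square-root witness `r` (`ρ r = −r`, `Θ(ρ r) = r`, `r² = j D`) and `hdK : |u² + 4w|_F = |ϖ_F|^{dK}`: **`dK = d`**.  Proof: the root
`τ = (ju + r∕jz)∕2` is a `Θρ`-fixed uniformiser of `M` (`|τ·ρτ| = |jw| = exp(−2)`), so `|τ − ρτ| = exp(−d)` by (dK-2), and `(τ − ρτ)² = j(u² + 4w)`.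
[cite: Serre1979, Ch. I §6 Prop. 17–18; Ch. III §4 Prop. 8] [cite: Omeara1963, §63B (63:3)] [cite: LabesseLanglands1979, §2 pp. 7–8] -/
theorem discDepth_eq_of_eisenstein {F M : Type} [Field F] [Valued F ℤᵐ⁰] [Field M] [Valued M ℤᵐ⁰]
    (j : F →+* M) (ρ Θ : M →+* M) (hj : ∀ y, Valued.v (j y) = Valued.v y ^ 2) (hjρ : ∀ y, ρ (j y) = j y) (hjΘ : ∀ y, Θ (j y) = j y)
    (hvρ : ∀ x, Valued.v (ρ x) = Valued.v x) (hΘΘ : ∀ x, Θ (Θ x) = x)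
    {ϖE : M} {d t : ℕ} (hDΘ : IsRamifiedQuadraticDatum Θ ϖE d t) (h2 : (2 : M) ≠ 0)
    {D u w z : F} (hD : (u ^ 2 + 4 * w) * z ^ 2 = D) (hz : z ≠ 0)
    {ϖF : F} (hϖF : Valued.v ϖF = exp (-1 : ℤ)) (hw : Valued.v w = Valued.v ϖF)
    {r : M} (hρr : ρ r = -r) (hΘρr : Θ (ρ r) = r) (hr : r ^ 2 = j D)
    {dK : ℕ} (hdK : Valued.v (u ^ 2 + 4 * w) = Valued.v ϖF ^ dK) : dK = d := by
  obtain ⟨-, hprod⟩ := root_sum_and_prod j h2 hD hz hr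
  set τ : M := (j u + r / j z) / 2 with hτ
  set τ' : M := j u - (j u + r / j z) / 2 with hτ'
  have hρτ : ρ τ = τ' := map_root_eq_conj j ρ hjρ hρr h2
  have hΘρτ : Θ (ρ τ) = τ := map_map_root_eq j ρ Θ hjρ hjΘ hΘρr
  -- `τ` is a uniformiser of `M`: `|τ·τ′| = |jw| = exp(−2)`, `|τ′| = |ρτ| = |τ|`
  have hτv : Valued.v τ = exp (-1 : ℤ) := by
    have hsq : Valued.v τ * Valued.v τ = exp (-2 : ℤ) := by
      have h1 : Valued.v τ * Valued.v τ' = exp (-2 : ℤ) := by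
        rw [← map_mul, hprod, Valuation.map_neg, hj, hw, hϖF, ← exp_nsmul]; norm_num
      have h1' : Valued.v τ' = Valued.v τ := by rw [← hρτ, hvρ]
      rw [h1'] at h1; exact h1
    have hτ0 : Valued.v τ ≠ 0 := fun h => by rw [h, zero_mul] at hsq; exact (exp_ne_zero hsq.symm).elim
    rw [← exp_log hτ0, ← exp_add, exp_inj] at hsq
    rw [← exp_log hτ0]; congr 1; omega
  -- (dK-2): `|τ − ρτ| = exp(−d)`
  have hdepth := F0P3cDyRamFrameRamKAtPlace.v_sub_rho_eq_of_tau_fixed ρ Θ hΘΘ hDΘ hΘρτ hτv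
  -- `(τ − ρτ)² = j(u² + 4w)`
  have hjz : j z ≠ 0 := (map_ne_zero j).2 hz
  have hδ : τ - ρ τ = r / j z := by
    rw [hρτ, hτ', hτ]; field_simp; ring
  have hδsq : (τ - ρ τ) ^ 2 = j (u ^ 2 + 4 * w) := by
    have huw : u ^ 2 + 4 * w = D / z ^ 2 := by rw [← hD, mul_div_cancel_right₀ _ (pow_ne_zero 2 hz)]
    rw [hδ, div_pow, hr, ← map_pow, ← map_div₀, huw]
  -- compare valuations: `exp(−2d) = |j(u² + 4w)| = |ϖ_F|^{2dK}`
  have hval := congrArg Valued.v hδsq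
  rw [map_pow, hdepth, hτv, hj, hdK, hϖF, ← pow_mul, ← pow_mul, ← exp_nsmul, ← exp_nsmul, exp_inj] at hval
  simp only [nsmul_eq_mul] at hval
  push_cast at hval
  omega

end Summit.HodgeConjecture.HodgeConjecture.Cruxes.H413.F0P3cDyRamRamKDiscDepth

end
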